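import Summits.CriticalPhenomena.PercolationContinuityZ3.Theorems.PercNearOneGluingNoHeavyQuantPoissonBinomialRatio
import HarnessLib

/-!
# QUANT lane R8 tool: the Poisson-binomial count recursion `PB[p, m]` (law of the number of successes among the first `m`
# of a sequence of independent trials) — bookkeeping, head split, a linear lower bound, and the ratio bound up to the mean

builds on p205010 (kernel theorem, internal audit signed; external expert review pending)

Support file (`--supports stmt-CriticalPhenomena-4575`), QUANT lane seat prim-quant-p1 (gen 6), rung R8 of
`run/shared/lean/prim/quant/LADDER.md`; memo `run/shared/lean/prim/quant/P1-SURPLUS.md` §17.  Elementary toolkit for the SOJOURN LEMMA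
(`…QuantSojourn.lean`: if `p₀ + Σ_{k<K} p_k > 2j` then the success count of the trials spends expected time `≥ 1` at level `j`), which is
the law-free core of "FAR (`Quant.FarRelayRow`) holds at EVERY layer on combs" (lead g8 LEAD-NOTES-G8 N19 (2)).  Pure real algebra on an
explicit recursion; no probability space except in the transfer of `Quant.pb_ratio`; no definitions (a local notation for a `Nat.rec` term),
no sorries, standard axioms.

**Setting.**  `p : ℕ → ℝ` a sequence of success probabilities (`0 ≤ p k ≤ 1` where needed).  `PB[p, m] b` is the probability that exactly
`b` of the first `m` trials succeed, DEFINED by the recursion `PB[p, 0] b = [b = 0]`,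
`PB[p, m+1] b = p m · PB[p, m] (b−1) + (1 − p m) · PB[p, m] b` (the `b−1` term absent for `b = 0`).

* `Quant.CountDP.PB_succ_zero` / `PB_succ_succ` / `PB_nonneg` / `PB_eq_zero_of_lt` / `PB_sum_eq_one` / `PB_zero_antitone` — bookkeeping;
  `cdf_succ` — `Σ_{i≤j} PB[p, m+1] i = Σ_{i≤j} PB[p, m] i − p m · PB[p, m] j` (one more trial lowers the cdf by the crossing mass).
* `Quant.CountDP.PB_head` — HEAD SPLIT: `PB[p, m+1] b = p 0 · PB[p∘succ, m] (b−1) + (1 − p 0) · PB[p∘succ, m] b` (condition on the first trial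
  instead of the last; the recursion commutes).
* `Quant.CountDP.PB_ge_linear` — LINEAR LOWER BOUND against level `0`: `PB[p, m] i ≥ (μ_m − i + 1) · PB[p, m] 0` for `i ≥ 1`,
  `μ_m = Σ_{k<m} p k` (induction on `m`; equality-free, valid for every sign of the bracket).
* `Quant.CountDP.PB_level_ge_zero_of_head` — for `j ≥ 2`: if `p 0 + Σ_{k<n} p k > j` then `PB[p, n] j ≥ PB[p, n] 0` (head split + the linear
  bound on the tail: `p₀(μ′−j+2) + (1−p₀)(μ′−j+1)₊ ≥ (1−p₀)` because `μ′ > j − 2p₀`).  False for `j = 1` (e.g. `(1/4, (21/200)×5)`).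
* `Quant.CountDP.PB_eq_prodBernoulli` — the canonical model: for `p : ℕ → [0,1]` and `m ≤ M`, `PB[p, m] b` is the `prodBernoulli`-probability
  that exactly `b` of the coordinates `{i : Fin M | i < m}` are open (by `Quant.pb_count_succ_split` / `pb_count_zero_split`); hence
* `Quant.CountDP.PB_ratio` — THE RATIO BOUND (`Quant.pb_ratio` transferred): `μ_m · PB[p, m] (b−1) ≤ b · PB[p, m] b` for `1 ≤ b ≤ μ_m`, and
  `Quant.CountDP.PB_mono_of_le_mean` — the pmf is nondecreasing on `[0, μ_m]`: `PB[p, m] i ≤ PB[p, m] i'` for `i ≤ i' ≤ μ_m`.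
Exact numerical re-check of every displayed inequality: `work/explore/check_sojourn.py` in the seat folder (≈ 150 000 instances, 0 violations).
Nearest prior art: Darroch 1964 / Samuels 1965 (mode of the Poisson binomial), size-biasing; the statements here are bookkeeping for
`…QuantSojourn.lean`; [this work] unless marked [folklore].
-/

noncomputable section

namespace Summit.CriticalPhenomena.PercolationContinuityZ3.Theorems

namespace Quant

namespace CountDP

open Finset MeasureTheory
open Literature.Probability.LatticeModels
open Literature.Probability.Percolation
open scoped Classical

/-- `PB[p, m] b` = probability that exactly `b` of the first `m` independent trials (success probabilities `p 0, …, p (m−1)`) succeed,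
as the explicit recursion on `m`. -/
local notation3 "PB[" p ", " m "]" =>
  (Nat.rec (motive := fun _ => ℕ → ℝ) (fun b => if b = 0 then (1 : ℝ) else 0)
    (fun n f b => (p : ℕ → ℝ) n * (if b = 0 then (0 : ℝ) else f (b - 1)) + (1 - (p : ℕ → ℝ) n) * f b) (m : ℕ))

variable (p : ℕ → ℝ)

/-! ### The recursion -/

/-- No trials: the count is `0`. [folklore] -/
theorem PB_zero (b : ℕ) : PB[p, 0] b = if b = 0 then (1 : ℝ) else 0 := rfl

/-- One more trial (raw form of the recursion). [folklore] -/
theorem PB_succ (m b : ℕ) :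
    PB[p, m + 1] b = p m * (if b = 0 then (0 : ℝ) else PB[p, m] (b - 1)) + (1 - p m) * PB[p, m] b := rfl

/-- One more trial, positive level: `PB[p, m+1] (b+1) = p m · PB[p, m] b + (1 − p m) · PB[p, m] (b+1)`. [folklore] -/
theorem PB_succ_succ (m b : ℕ) :
    PB[p, m + 1] (b + 1) = p m * PB[p, m] b + (1 - p m) * PB[p, m] (b + 1) := by
  rw [PB_succ]; simp

/-- One more trial, level zero: `PB[p, m+1] 0 = (1 − p m) · PB[p, m] 0`. [folklore] -/
theorem PB_succ_zero (m : ℕ) : PB[p, m + 1] 0 = (1 - p m) * PB[p, m] 0 := by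
  rw [PB_succ]; simp

/-- `PB[p, 0] 0 = 1`. [folklore] -/
theorem PB_zero_zero : PB[p, 0] 0 = 1 := by rw [PB_zero]; simp

/-- `PB[p, 0] (b+1) = 0`. [folklore] -/
theorem PB_zero_succ (b : ℕ) : PB[p, 0] (b + 1) = 0 := by rw [PB_zero]; simp

/-! ### Bookkeeping -/

/-- The count never exceeds the number of trials. [folklore] -/
theorem PB_eq_zero_of_lt (m : ℕ) : ∀ b, m < b → PB[p, m] b = 0 := by
  induction m with
  | zero =>
    intro b hb
    obtain ⟨b, rfl⟩ : ∃ b', b = b' + 1 := ⟨b - 1, by omega⟩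
    exact PB_zero_succ p b
  | succ m ih =>
    intro b hb
    obtain ⟨b, rfl⟩ : ∃ b', b = b' + 1 := ⟨b - 1, by omega⟩
    rw [PB_succ_succ, ih b (by omega), ih (b + 1) (by omega)]
    ring

/-- Nonnegativity (probabilities in `[0,1]`). [folklore] -/
theorem PB_nonneg (hp : ∀ k, 0 ≤ p k ∧ p k ≤ 1) (m : ℕ) : ∀ b, 0 ≤ PB[p, m] b := by
  induction m with
  | zero => intro b; rw [PB_zero]; split_ifs <;> norm_num
  | succ m ih =>
    intro b
    cases b with
    | zero => rw [PB_succ_zero]; exact mul_nonneg (by linarith [hp m]) (ih 0)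
    | succ b =>
      rw [PB_succ_succ]
      exact add_nonneg (mul_nonneg (hp m).1 (ih b)) (mul_nonneg (by linarith [hp m]) (ih (b + 1)))

/-- Total mass one: `Σ_{b ≤ m} PB[p, m] b = 1`. [folklore] -/
theorem PB_sum_eq_one (m : ℕ) : ∑ b ∈ Finset.range (m + 1), PB[p, m] b = 1 := by
  induction m with
  | zero => rw [Finset.sum_range_one, PB_zero_zero]
  | succ m ih =>
    rw [Finset.sum_range_succ', PB_succ_zero]
    have h1 : ∑ b ∈ Finset.range (m + 1), PB[p, m + 1] (b + 1) =
        p m * ∑ b ∈ Finset.range (m + 1), PB[p, m] b + (1 - p m) * ∑ b ∈ Finset.range (m + 1), PB[p, m] (b + 1) := by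
      rw [Finset.mul_sum, Finset.mul_sum, ← Finset.sum_add_distrib]
      exact Finset.sum_congr rfl fun b _ => PB_succ_succ p m b
    have h2 : ∑ b ∈ Finset.range (m + 1), PB[p, m] (b + 1) = 1 - PB[p, m] 0 := by
      have h3 := ih
      rw [Finset.sum_range_succ'] at h3
      rw [Finset.sum_range_succ, PB_eq_zero_of_lt p m (m + 1) (by omega)]
      linarith
    rw [h1, ih, h2]
    ring

/-- `PB[p, ·] 0` is nonincreasing in the number of trials: `PB[p, n] 0 ≤ PB[p, m] 0` for `m ≤ n`. [folklore] -/
theorem PB_zero_antitone (hp : ∀ k, 0 ≤ p k ∧ p k ≤ 1) {m n : ℕ} (hmn : m ≤ n) : PB[p, n] 0 ≤ PB[p, m] 0 := by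
  induction n with
  | zero =>
    have : m = 0 := by omega
    subst this; exact le_rfl
  | succ n ih =>
    rcases Nat.lt_or_ge m (n + 1) with h | h
    · rw [PB_succ_zero]
      have h0 := PB_nonneg p hp n 0
      nlinarith [ih (by omega), hp n]
    · have : m = n + 1 := by omega
      subst this; exact le_rfl

/-- **cdf step**: `Σ_{i ≤ j} PB[p, m+1] i = Σ_{i ≤ j} PB[p, m] i − p m · PB[p, m] j` — one more trial lowers the probability of
`{count ≤ j}` by exactly the crossing mass `p m · PB[p, m] j`. [folklore] -/
theorem cdf_succ (m j : ℕ) :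
    ∑ i ∈ Finset.range (j + 1), PB[p, m + 1] i = ∑ i ∈ Finset.range (j + 1), PB[p, m] i - p m * PB[p, m] j := by
  induction j with
  | zero => rw [Finset.sum_range_one, Finset.sum_range_one, PB_succ_zero]; ring
  | succ j ih =>
    rw [Finset.sum_range_succ, ih, PB_succ_succ, Finset.sum_range_succ _ (j + 1)]
    ring

/-- Tail step: `Σ_{i ≤ j} PB[p, m] i − Σ_{i ≤ j} PB[p, m+1] i = p m · PB[p, m] j ≥ 0` packaged as the
difference of the complementary tails. [folklore] -/
theorem tail_succ_sub (m j : ℕ) :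
    (1 - ∑ i ∈ Finset.range (j + 1), PB[p, m + 1] i) - (1 - ∑ i ∈ Finset.range (j + 1), PB[p, m] i) =
      p m * PB[p, m] j := by
  rw [cdf_succ]; ring

/-! ### Head split: conditioning on the FIRST trial -/

/-- **Head split.**  `PB[p, m+1] b = p 0 · PB[p ∘ succ, m] (b−1) + (1 − p 0) · PB[p ∘ succ, m] b` (the `b−1` term absent for `b = 0`):
the recursion (which appends trials at the end) also splits off the first trial. [folklore] -/
theorem PB_head (m : ℕ) : ∀ b, PB[p, m + 1] b =
    p 0 * (if b = 0 then (0 : ℝ) else PB[(fun k => p (k + 1)), m] (b - 1)) + (1 - p 0) * PB[(fun k => p (k + 1)), m] b := by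
  set p' : ℕ → ℝ := fun k => p (k + 1) with hp'
  induction m with
  | zero =>
    intro b
    rw [PB_succ]
    simp only [PB_zero]
  | succ m ih =>
    intro b
    cases b with
    | zero =>
      rw [PB_succ_zero, ih 0, PB_succ_zero p' m]
      simp only [if_true, mul_zero, zero_add, hp']
      ring
    | succ b =>
      rw [PB_succ_succ, ih b, ih (b + 1), PB_succ_succ p' m b]
      cases b with
      | zero =>
        rw [PB_succ_zero p' m]
        simp only [if_true, mul_zero, zero_add, one_ne_zero, if_false, hp']
        ring
      | succ b =>
        -- `simp` also unfolds the recursion at `m + 1`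
        simp only [Nat.add_one_ne_zero, if_false, Nat.add_sub_cancel, hp']
        ring

/-- Head split, positive level. [folklore] -/
theorem PB_head_succ (m b : ℕ) :
    PB[p, m + 1] (b + 1) = p 0 * PB[(fun k => p (k + 1)), m] b + (1 - p 0) * PB[(fun k => p (k + 1)), m] (b + 1) := by
  rw [PB_head]; simp

/-- Head split, level zero. [folklore] -/
theorem PB_head_zero (m : ℕ) : PB[p, m + 1] 0 = (1 - p 0) * PB[(fun k => p (k + 1)), m] 0 := by
  rw [PB_head]; simp

/-! ### The linear lower bound against level zero -/

/-- **Linear lower bound.**  For `i ≥ 1`: `PB[p, m] i ≥ (μ_m − i + 1) · PB[p, m] 0`, `μ_m = Σ_{k<m} p k` (the odds form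
`e_i(p/(1−p)) ≥ Σ p − i + 1`; induction on `m`, valid whatever the sign of the bracket). [this work] -/
theorem PB_ge_linear (hp : ∀ k, 0 ≤ p k ∧ p k ≤ 1) (m : ℕ) :
    ∀ i, 1 ≤ i → ((∑ k ∈ Finset.range m, p k) - i + 1) * PB[p, m] 0 ≤ PB[p, m] i := by
  induction m with
  | zero =>
    intro i hi
    obtain ⟨i, rfl⟩ : ∃ i', i = i' + 1 := ⟨i - 1, by omega⟩
    rw [PB_zero_succ, PB_zero_zero, Finset.sum_range_zero]
    push_cast
    nlinarith
  | succ m ih =>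
    intro i hi
    have h0 := PB_nonneg p hp m 0
    have hpm := hp m
    set μ := ∑ k ∈ Finset.range m, p k with hμ
    rw [Finset.sum_range_succ, ← hμ]
    obtain ⟨i, rfl⟩ : ∃ i', i = i' + 1 := ⟨i - 1, by omega⟩
    rw [PB_succ_zero, PB_succ_succ]
    cases i with
    | zero =>
      -- level one: `p·P₀ + (1−p)·P(1) ≥ (p + (1−p)μ)·P₀ ≥ (μ + p)(1−p)·P₀`
      have h1 := ih 1 le_rfl
      have hP1 := PB_nonneg p hp m 1
      have e0 : PB[p, m] (0 + 1) = PB[p, m] 1 := rfl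
      rw [e0]
      push_cast at h1 ⊢
      have e1 : (1 - p m) * (μ * PB[p, m] 0) ≤ (1 - p m) * PB[p, m] 1 :=
        mul_le_mul_of_nonneg_left (by linarith) (by linarith)
      nlinarith [mul_nonneg (mul_nonneg hpm.1 hpm.1) h0]
    | succ i =>
      have h1 := ih (i + 1) (by omega)
      have h2 := ih (i + 2) (by omega)
      have hP1 := PB_nonneg p hp m (i + 1)
      have hP2 := PB_nonneg p hp m (i + 2)
      have e0 : PB[p, m] (i + 1 + 1) = PB[p, m] (i + 2) := rfl
      rw [e0]
      push_cast at h1 h2 ⊢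
      -- `p·P(i+1) + (1−p)·P(i+2) ≥ A·P₀` with `A = μ − i − 1 + p`; the target is `A(1−p)·P₀`
      have e1 : p m * ((μ - ((i : ℝ) + 1) + 1) * PB[p, m] 0) ≤ p m * PB[p, m] (i + 1) :=
        mul_le_mul_of_nonneg_left h1 hpm.1
      have e2 : (1 - p m) * ((μ - ((i : ℝ) + 2) + 1) * PB[p, m] 0) ≤ (1 - p m) * PB[p, m] (i + 2) :=
        mul_le_mul_of_nonneg_left h2 (by linarith)
      by_cases hA : 0 ≤ μ - (i : ℝ) - 1 + p m
      · have e3 : 0 ≤ (μ - (i : ℝ) - 1 + p m) * p m * PB[p, m] 0 := mul_nonneg (mul_nonneg hA hpm.1) h0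
        nlinarith
      · push Not at hA
        have e3 : (μ - (i : ℝ) - 1 + p m) * ((1 - p m) * PB[p, m] 0) ≤ 0 :=
          mul_nonpos_of_nonpos_of_nonneg hA.le (mul_nonneg (by linarith) h0)
        nlinarith

/-- **Level `j` beats level `0` when the head-weighted mean exceeds `j` (`j ≥ 2`).**  If `p 0 + Σ_{k<n} p k > j` (`n ≥ 1`) then
`PB[p, n] 0 ≤ PB[p, n] j`.  Proof: split off the first trial and apply the linear bound to the remaining `n−1` trials, whose mean
`μ′` exceeds `j − 2·p 0`: `p₀(μ′−j+2) + (1−p₀)(μ′−j+1)₊ > 2p₀(1−p₀) + (1−p₀)(1−2p₀)₊ ≥ 1 − p₀`.  (False for `j = 1`.) [this work] -/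
theorem PB_level_ge_zero_of_head (hp : ∀ k, 0 ≤ p k ∧ p k ≤ 1) (n j : ℕ) (hj : 2 ≤ j) (hn : 1 ≤ n)
    (hmean : (j : ℝ) < p 0 + ∑ k ∈ Finset.range n, p k) : PB[p, n] 0 ≤ PB[p, n] j := by
  obtain ⟨n, rfl⟩ : ∃ n', n = n' + 1 := ⟨n - 1, by omega⟩
  obtain ⟨j, rfl⟩ : ∃ j', j = j' + 1 := ⟨j - 1, by omega⟩
  rw [PB_head_zero, PB_head_succ]
  set p' : ℕ → ℝ := fun k => p (k + 1) with hp'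
  have hp'01 : ∀ k, 0 ≤ p' k ∧ p' k ≤ 1 := fun k => hp (k + 1)
  -- the tail mean
  set μ' := ∑ k ∈ Finset.range n, p' k with hμ'
  have hsum : ∑ k ∈ Finset.range (n + 1), p k = p 0 + μ' := by
    rw [Finset.sum_range_succ', hμ']
    ring
  rw [hsum] at hmean
  push_cast at hmean
  have h0 := PB_nonneg p' hp'01 n 0
  have hA := PB_ge_linear p' hp'01 n j (by omega)
  have hB := PB_ge_linear p' hp'01 n (j + 1) (by omega)
  rw [← hμ'] at hA hB
  push_cast at hA hB
  have hBnn := PB_nonneg p' hp'01 n (j + 1)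
  have hp0 := hp 0
  -- `p₀·PB'(j) ≥ p₀(μ' − j + 1)·P₀'` and `(1−p₀)·PB'(j+1) ≥ (1−p₀)(μ' − j)·P₀'`
  have e1 : p 0 * ((μ' - (j : ℝ) + 1) * PB[p', n] 0) ≤ p 0 * PB[p', n] j := mul_le_mul_of_nonneg_left hA hp0.1
  have e2 : (1 - p 0) * ((μ' - ((j : ℝ) + 1) + 1) * PB[p', n] 0) ≤ (1 - p 0) * PB[p', n] (j + 1) :=
    mul_le_mul_of_nonneg_left hB (by linarith)
  by_cases hhalf : 1 / 2 ≤ p 0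
  · -- use `e1` only: `p₀(μ' − j + 1) > p₀(2 − 2p₀) ≥ 1 − p₀`
    have e3 : 0 ≤ (1 - p 0) * PB[p', n] (j + 1) := mul_nonneg (by linarith) hBnn
    have e4 : (1 - p 0) * PB[p', n] 0 ≤ p 0 * ((μ' - (j : ℝ) + 1) * PB[p', n] 0) := by
      have : (1 - p 0) ≤ p 0 * (μ' - (j : ℝ) + 1) := by nlinarith
      nlinarith
    linarith
  · push Not at hhalf
    have e4 : (1 - p 0) * PB[p', n] 0 ≤
        p 0 * ((μ' - (j : ℝ) + 1) * PB[p', n] 0) + (1 - p 0) * ((μ' - ((j : ℝ) + 1) + 1) * PB[p', n] 0) := by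
      have : (1 - p 0) ≤ p 0 * (μ' - (j : ℝ) + 1) + (1 - p 0) * (μ' - ((j : ℝ) + 1) + 1) := by nlinarith
      nlinarith
    linarith

/-! ### The canonical model and the ratio bound up to the mean -/

/-- **Canonical model.**  For `0 ≤ p k ≤ 1` and `m ≤ M`, `PB[p, m] b` is the `prodBernoulli`-probability (independent coordinates
`i : Fin M`, open with probability `p i`) that exactly `b` of the coordinates `i < m` are open.  Induction on `m` with
`Quant.pb_count_succ_split` / `Quant.pb_count_zero_split` at the coordinate `i = m`. [folklore] -/
theorem PB_eq_prodBernoulli (hp : ∀ k, 0 ≤ p k ∧ p k ≤ 1) (M : ℕ) :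
    ∀ m, m ≤ M → ∀ b, PB[p, m] b =
      (prodBernoulli (fun i : Fin M => (⟨p i, (hp i).1, (hp i).2⟩ : unitInterval))).real
        {s : Set (Fin M) | (((Finset.univ : Finset (Fin M)).filter fun i : Fin M => i.val < m).filter
          fun x => x ∈ s).card = b} := by
  set pp : Fin M → unitInterval := fun i => ⟨p i, (hp i).1, (hp i).2⟩ with hpp
  intro m
  induction m with
  | zero =>
    intro _ b
    have hempty : ((Finset.univ : Finset (Fin M)).filter fun i : Fin M => i.val < 0) = ∅ := by
      ext i; simp
    rw [hempty, PB_zero]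
    cases b with
    | zero =>
      simp only [if_true, Finset.filter_empty, Finset.card_empty, Set.setOf_true, probReal_univ]
    | succ b =>
      rw [if_neg (Nat.succ_ne_zero b)]
      have : {s : Set (Fin M) | ((∅ : Finset (Fin M)).filter fun x => x ∈ s).card = b + 1} = ∅ := by
        ext s
        simp only [Finset.filter_empty, Finset.card_empty, Set.mem_setOf_eq, Set.mem_empty_iff_false, iff_false]
        omega
      rw [this, measureReal_empty]
  | succ m ih =>
    intro hm b
    set L : Finset (Fin M) := (Finset.univ : Finset (Fin M)).filter fun i : Fin M => i.val < m + 1 with hL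
    set i0 : Fin M := ⟨m, by omega⟩ with hi0
    have hmem : i0 ∈ L := by
      rw [hL, Finset.mem_filter]; exact ⟨Finset.mem_univ _, by simp [hi0]⟩
    -- (`Quant.pb_count_*_split` erase with the classical `DecidableEq`; state the identification with that instance)
    have herase : @Finset.erase (Fin M) (fun a b => Classical.propDecidable (a = b)) L i0 =
        (Finset.univ : Finset (Fin M)).filter fun i : Fin M => i.val < m := by
      ext i
      simp only [hL, hi0, Finset.mem_erase, Finset.mem_filter, Finset.mem_univ, true_and, ne_eq, Fin.ext_iff]
      omega
    have hpi0 : (pp i0 : ℝ) = p m := by simp [hpp, hi0]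
    cases b with
    | zero =>
      rw [PB_succ_zero, pb_count_zero_split pp L hmem, herase, hpi0, ih (by omega) 0]
    | succ b =>
      rw [PB_succ_succ, pb_count_succ_split pp L hmem b, herase, hpi0, ih (by omega) b, ih (by omega) (b + 1)]

/-- **The ratio bound up to the mean** (`Quant.pb_ratio` transferred to the recursion): for `0 ≤ p k ≤ 1` and every integer
`b` with `1 ≤ b ≤ μ_m = Σ_{k<m} p k`:  `μ_m · PB[p, m] (b−1) ≤ b · PB[p, m] b`. [this work] -/
theorem PB_ratio (hp : ∀ k, 0 ≤ p k ∧ p k ≤ 1) (m b : ℕ) (hb1 : 1 ≤ b)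
    (hbU : (b : ℝ) ≤ ∑ k ∈ Finset.range m, p k) :
    (∑ k ∈ Finset.range m, p k) * PB[p, m] (b - 1) ≤ (b : ℝ) * PB[p, m] b := by
  set pp : Fin m → unitInterval := fun i => ⟨p i, (hp i).1, (hp i).2⟩ with hpp
  have hsum : ∑ i ∈ (Finset.univ : Finset (Fin m)), (pp i : ℝ) = ∑ k ∈ Finset.range m, p k := by
    simp only [hpp]
    exact Fin.sum_univ_eq_sum_range (fun k => p k) m
  have huniv : ((Finset.univ : Finset (Fin m)).filter fun i : Fin m => i.val < m) = Finset.univ := by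
    ext i; simp
  have key := pb_ratio pp Finset.univ b hb1 (by rw [hsum]; exact hbU)
  rw [hsum] at key
  have e1 := PB_eq_prodBernoulli p hp m m le_rfl (b - 1)
  have e2 := PB_eq_prodBernoulli p hp m m le_rfl b
  rw [huniv] at e1 e2
  rw [e1, e2]
  exact key

/-- **The pmf is nondecreasing up to the mean**: `PB[p, m] i ≤ PB[p, m] i'` for naturals `i ≤ i' ≤ μ_m`. [this work] -/
theorem PB_mono_of_le_mean (hp : ∀ k, 0 ≤ p k ∧ p k ≤ 1) (m i i' : ℕ) (hii' : i ≤ i')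
    (hi'U : (i' : ℝ) ≤ ∑ k ∈ Finset.range m, p k) : PB[p, m] i ≤ PB[p, m] i' := by
  obtain ⟨d, rfl⟩ : ∃ d, i' = i + d := ⟨i' - i, by omega⟩
  induction d with
  | zero => simp
  | succ d ih =>
    have hcast : ((i + d : ℕ) : ℝ) ≤ ∑ k ∈ Finset.range m, p k := by
      have : ((i + d : ℕ) : ℝ) ≤ ((i + (d + 1) : ℕ) : ℝ) := by exact_mod_cast (by omega : i + d ≤ i + (d + 1))
      linarith
    have h1 := ih (by omega) hcast
    -- ratio bound at `b = i + d + 1`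
    have hr := PB_ratio p hp m (i + d + 1) (by omega) (by
      have : ((i + d + 1 : ℕ) : ℝ) = ((i + (d + 1) : ℕ) : ℝ) := by push_cast; ring
      rw [this]; exact hi'U)
    have hsub : i + d + 1 - 1 = i + d := by omega
    rw [hsub] at hr
    have hnn := PB_nonneg p hp m (i + d + 1)
    have hμpos : (0 : ℝ) < ∑ k ∈ Finset.range m, p k := by
      have : (1 : ℝ) ≤ ((i + (d + 1) : ℕ) : ℝ) := by exact_mod_cast (by omega : 1 ≤ i + (d + 1))
      linarith
    have hle : ((i + d + 1 : ℕ) : ℝ) ≤ ∑ k ∈ Finset.range m, p k := by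
      have : ((i + d + 1 : ℕ) : ℝ) = ((i + (d + 1) : ℕ) : ℝ) := by push_cast; ring
      rw [this]; exact hi'U
    -- `μ·PB(i+d) ≤ (i+d+1)·PB(i+d+1) ≤ μ·PB(i+d+1)`
    have h2 : (∑ k ∈ Finset.range m, p k) * PB[p, m] (i + d) ≤ (∑ k ∈ Finset.range m, p k) * PB[p, m] (i + d + 1) := by
      nlinarith
    have h3 : PB[p, m] (i + d) ≤ PB[p, m] (i + d + 1) := le_of_mul_le_mul_left h2 hμpos
    have e : PB[p, m] (i + (d + 1)) = PB[p, m] (i + d + 1) := by rw [Nat.add_assoc]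
    rw [e]
    exact h1.trans h3

end CountDP

end Quant

end Summit.CriticalPhenomena.PercolationContinuityZ3.Theorems

end
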